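import Summits.NavierStokesRegularity.FluidComputer.BlockQuadTransit

/-!
# PSEUDO-ORBIT DELAYED ABRUPT TRANSITION for the quadratic gate under a RELATIVE defect

HONEST FRAMING (page 1): this file belongs to a low prior, high value-of-information experiment on
Tao's machine paradigm; it is NOT a claim that NS blows up. It is design-level calculus about the
planar quadratic design field `quadVF k η (a, b) = (−kηab, ka²)` (`BlockQuadGate.lean`) and curves
whose right derivative is within `ε (1 + ‖z‖)` of it; nothing here is a statement about NS.

WHY. The viscous tests of the block line (`BlockReachViscous.lean`, `BlockReachProbe.lean`,
`BlockReachVoid.lean`, `BlockPairCeiling.lean`) refute every residue with an ABSOLUTE readout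
tolerance on an amplitude-unbounded working region, by witnesses PROPORTIONAL TO THE AMPLITUDE, so
the reach layer is re-typed with the RELATIVE tolerance `ε (1 + ‖read‖)` (`BlockVarCircuit.lean`,
`BlockVarCascade.lean`, `BlockRelReach.lean`); its circuit half needs the quadratic transit gate to
deliver the transition `AinO → AoutO` (`Params.reg`) against right-derivative defects of that size.
Rescaling the absolute theorem `quad_pseudoOrbit_datO` (`z ↦ z / R`) does not give it: the spent
window `|a| ≤ σsp` is ABSOLUTE while the adversary pushes with force `≈ ε R`. Proved here directly —
the gate's own contraction rate `kηb ≈ k√η R` outgrows the relative forcing.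

WHAT IS PROVED ([folklore] throughout). §1 `pseudo_energy_band_rel`: the energy band
`(1 + W₀) e^{∓8εt}` along such curves (`|W'| ≤ 8ε (1 + W)`), i.e. the tube `quadTube η (4ε)` of
`BlockQuadReach.lean`. §2 `rel_pseudoOrbit_datO`: for `Params.reg`, `η ∈ [1/2, 9/10]`, `k ≥ 6`,
`0 ≤ ε ≤ 1/2500`, every such curve from `AinO` is in `AoutO` at rescaled time `1`, at EVERY
amplitude — small amplitudes (`W₀ ≤ 8`) by the absolute theorem (the defect is then absolutely
`≤ 1/400`), large ones by a two-phase argument (gap decay until `√η b ≥ 0.845 r`, then Grönwall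
with NEGATIVE rate `−3.5 r` for `a²` against the forcing `2|a|ε'`, `ε' ≤ r/1250`). Consumed by
`BlockRelTransit.lean` (the relative reach certificate of the quadratic transit design).
-/

open Set Filter Topology

namespace Summit.NavierStokesRegularity.FluidComputer

open Literature.Analysis.FluidPDE Literature.Analysis.FluidPDE.FluidComputer

namespace BlockDesign

variable {S : CascadeSpecs}

/-! ### §1. The energy band along a pseudo-orbit with RELATIVE defect -/

/-- Sup norm versus energy radius: `‖z‖ ≤ (3/2) R`, `R = √(a² + η b²)`, for `η ≥ 1/2`
(`|a| ≤ R`, `(2/3)|b| ≤ √η |b| ≤ R`). [folklore] -/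
theorem norm_le_qRad {η : ℝ} (hη : 1 / 2 ≤ η) (z : ℝ × ℝ) : ‖z‖ ≤ 3 / 2 * qRad η z := by
  have hη0 : 0 ≤ η := by linarith only [hη]
  have ha := abs_fst_le_qRad hη0 z
  have hb := sqrt_mul_abs_snd_le_qRad hη0 z
  have hs : (2 : ℝ) / 3 ≤ Real.sqrt η := by
    rw [Real.le_sqrt' (by norm_num)]; norm_num; linarith only [hη]
  have hR : 0 ≤ qRad η z := Real.sqrt_nonneg _
  have h2 := mul_le_mul_of_nonneg_right hs (abs_nonneg z.2)
  rw [Prod.norm_def, Real.norm_eq_abs, Real.norm_eq_abs]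
  exact max_le (by linarith only [ha, hR]) (by linarith only [hb, h2])

/-- ENERGY BAND, RELATIVE DEFECT: along a curve on `[0, T]` with right derivative `w t` and
`‖w t − quadVF k η (z t)‖ ≤ ε (1 + ‖z t‖)` (`1/2 ≤ η ≤ 1`, `ε ≥ 0`):
`(1 + W₀) e^{−8εt} ≤ 1 + W(t) ≤ (1 + W₀) e^{8εt}`, `W = a² + ηb²` — from the radial identity,
`|W'| ≤ 2 (|a| + η|b|) ε (1 + ‖z‖) ≤ 2·2R (1 + 3R/2) ε ≤ 8 ε (1 + W)`, and Grönwall both ways. Written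
with `2·(4ε)` so that the band is literally `quadTube η (4ε)`. Amplitude-uniform. [folklore] -/
theorem pseudo_energy_band_rel {η : ℝ} (hη : 1 / 2 ≤ η) (hη1 : η ≤ 1) (k : ℝ) {ε T : ℝ}
    (hε : 0 ≤ ε) {z w : ℝ → ℝ × ℝ} (hcont : ContinuousOn z (Icc 0 T))
    (hderiv : ∀ t ∈ Ico 0 T, HasDerivWithinAt z (w t) (Ici t) t)
    (hdef : ∀ t ∈ Ico 0 T, ‖w t - quadVF k η (z t)‖ ≤ ε * (1 + ‖z t‖)) :
    ∀ t ∈ Icc 0 T,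
      (1 + pairEnergy η (z 0)) * Real.exp (-(2 * (4 * ε)) * t) ≤ 1 + pairEnergy η (z t) ∧
        1 + pairEnergy η (z t) ≤ (1 + pairEnergy η (z 0)) * Real.exp (2 * (4 * ε) * t) := by
  have hη0 : 0 ≤ η := by linarith only [hη]
  set f : ℝ → ℝ := fun x => 1 + pairEnergy η (z x) with hfdef
  have hf : ContinuousOn f (Icc 0 T) :=
    continuousOn_const.add (continuousOn_pairEnergy_comp hcont η)
  have hf' : ∀ x ∈ Ico 0 T, HasDerivWithinAt f
      (2 * ((z x).1 * (w x).1 + η * (z x).2 * (w x).2)) (Ici x) x :=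
    fun x hx => (hasDerivWithinAt_pairEnergy_comp (hderiv x hx) η).const_add 1
  have hfpos : ∀ x, 0 < f x := fun x => by
    have := pairEnergy_nonneg hη0 (z x); simp only [hfdef]; linarith
  -- the key pointwise bound `|f'| ≤ 8ε f`
  have key : ∀ x ∈ Ico 0 T,
      |2 * ((z x).1 * (w x).1 + η * (z x).2 * (w x).2)| ≤ 2 * (4 * ε) * f x := by
    intro x hx
    have h1 := abs_radial_le hη0 k (hdef x hx)
    have h2 := abs_add_le_qRad hη0 (z x)
    have h3 := norm_le_qRad hη (z x)
    have hs1 : Real.sqrt η ≤ 1 := Real.sqrt_le_one.mpr hη1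
    have hR0 : 0 ≤ qRad η (z x) := Real.sqrt_nonneg _
    have hR2 : qRad η (z x) ^ 2 = pairEnergy η (z x) := Real.sq_sqrt (pairEnergy_nonneg hη0 _)
    have h4 : |(z x).1| + η * |(z x).2| ≤ 2 * qRad η (z x) := by
      have := mul_le_mul_of_nonneg_right hs1 hR0
      linarith only [h2, this]
    have h5 : ε * (1 + ‖z x‖) ≤ ε * (1 + 3 / 2 * qRad η (z x)) :=
      mul_le_mul_of_nonneg_left (by linarith only [h3]) hε
    have h50 : 0 ≤ ε * (1 + ‖z x‖) := mul_nonneg hε (by positivity)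
    have h6 : (|(z x).1| + η * |(z x).2|) * (ε * (1 + ‖z x‖))
        ≤ (2 * qRad η (z x)) * (ε * (1 + 3 / 2 * qRad η (z x))) :=
      mul_le_mul h4 h5 h50 (by positivity)
    have h7 : (2 * qRad η (z x)) * (ε * (1 + 3 / 2 * qRad η (z x))) ≤ 4 * ε * f x := by
      have h8 : 2 * qRad η (z x) * (1 + 3 / 2 * qRad η (z x)) ≤ 4 * (1 + qRad η (z x) ^ 2) := by
        nlinarith only [sq_nonneg (qRad η (z x) - 1), hR0]
      have h9 : f x = 1 + qRad η (z x) ^ 2 := by simp only [hfdef]; rw [hR2]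
      rw [h9]; nlinarith only [h8, hε]
    rw [abs_mul, abs_two]
    linarith only [h1, h6, h7]
  intro t ht
  constructor
  · -- lower bound: Grönwall for `−f` with rate `−8ε`
    have hg : ContinuousOn (fun x => -f x) (Icc 0 T) := hf.neg
    have h := le_gronwallBound_of_liminf_deriv_right_le (f := fun x => -f x)
      (f' := fun x => -(2 * ((z x).1 * (w x).1 + η * (z x).2 * (w x).2)))
      (δ := -f 0) (K := -(2 * (4 * ε))) (ε := 0) (a := 0) (b := T) hg
      (fun x hx r hr => by
        simpa [slope_def_module, smul_eq_mul] using ((hf' x hx).neg).liminf_right_slope_le hr)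
      le_rfl (fun x hx => by
        have := key x hx
        have h' := neg_abs_le (2 * ((z x).1 * (w x).1 + η * (z x).2 * (w x).2))
        nlinarith [h', this]) t ht
    rw [gronwallBound_ε0, sub_zero] at h
    simp only [hfdef] at h ⊢
    nlinarith [h]
  · -- upper bound: Grönwall for `f` with rate `8ε`
    have h := norm_le_gronwallBound_of_norm_deriv_right_le (f := f)
      (f' := fun x => 2 * ((z x).1 * (w x).1 + η * (z x).2 * (w x).2))
      (δ := f 0) (K := 2 * (4 * ε)) (ε := 0) (a := 0) (b := T) hf hf'
      (by rw [Real.norm_eq_abs, abs_of_pos (hfpos 0)])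
      (fun x hx => by
        rw [Real.norm_eq_abs, Real.norm_eq_abs, abs_of_pos (hfpos x), add_zero]
        exact key x hx) t ht
    rw [gronwallBound_ε0, sub_zero, Real.norm_eq_abs, abs_of_pos (hfpos t)] at h
    simpa only [hfdef] using h

/-! ### §2. Pseudo-orbit DAT for the quadratic gate with RELATIVE defect, amplitude-uniform -/

/-- PSEUDO-ORBIT DAT FOR THE QUADRATIC GATE, RELATIVE DEFECT (amplitude-uniform). For the windows
`Params.reg` (`aLo = 3/2`, `c0 = 3/20`, `δ = 1/20`, `σsp = 1/4`), `η ∈ [1/2, 9/10]`, `k ≥ 6`,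
`0 ≤ ε ≤ 1/2500`: if `z` is continuous on `[0, 1]` with right derivative `w t`,
`‖w t − quadVF k η (z t)‖ ≤ ε (1 + ‖z t‖)` on `[0, 1)`, and `z 0 ∈ AinO` (`a > 1.45`, `|b| < 0.2`,
ANY amplitude), then `z 1 ∈ AoutO` (`|a(1)| ≤ 1/4`, `b(1) ≥ 3/2`). Proof. By the relative band,
with `r² = (623 W₀ − 2)/625`: `r ≤ R ≤ 1.01 r`, `‖z‖ ≤ 1.515 r`, so the defect is ABSOLUTELY
`≤ ε' = ε (1 + 1.515 r)`. SMALL `W₀ ≤ 8`: `ε' ≤ 1/400` and `quad_pseudoOrbit_datO` applies. LARGE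
`W₀ ≥ 8` (`r ≥ 2.8`, `ε' ≤ r/1250`):
`√η b ≥ −1/5 − r/1250` (`pseudo_snd_lower`), gap decay with `κ = 3.9 r` (`pseudo_gap_decay`) gives
`√η b ≥ 0.845 r` on `[t₁, 1]`, `t₁ = 20/(39 r)` (`κ t₁ = 2`, `e^{-2} ≤ 1/7`); there `a²` obeys
`(a²)' = -2kηb a² + 2a e₁ ≤ -c a² + ε'²/c`, `c = 3.5 r ≤ kηb`, so Grönwall with NEGATIVE rate on
`[t₁, 1]` (`e^y ≥ y⁴/24`, `y = c (1 - t₁) = 3.5 r − 70/39 ≥ 8`, `441 r² ≤ y⁴`) gives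
`a(1)² ≤ 1.0201·24/441 + 4375⁻² < 1/17`, while `b(1) ≥ 0.845 r > 3/2`. Nothing about NS. [folklore] -/
theorem rel_pseudoOrbit_datO (hS : S.lam0 = 1) (hη : 1 / 2 ≤ S.eta) (hη2 : S.eta ≤ 9 / 10)
    {k : ℝ} (hk : 6 ≤ k) {ε : ℝ} (hε0 : 0 ≤ ε) (hε : ε ≤ 1 / 2500) {z w : ℝ → ℝ × ℝ}
    (hcont : ContinuousOn z (Icc 0 1))
    (hderiv : ∀ t ∈ Ico (0 : ℝ) 1, HasDerivWithinAt z (w t) (Ici t) t)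
    (hdef : ∀ t ∈ Ico (0 : ℝ) 1, ‖w t - quadVF k S.eta (z t)‖ ≤ ε * (1 + ‖z t‖))
    (h0 : z 0 ∈ AinO (Params.reg S hS hη)) :
    z 1 ∈ AoutO (Params.reg S hS hη) := by
  obtain ⟨ha0, hb0⟩ := AinO_bounds h0
  change (3 : ℝ) / 2 - 1 / 20 < (z 0).1 at ha0
  change |(z 0).2| < (3 : ℝ) / 20 + 1 / 20 at hb0
  have hI1 : (1 : ℝ) ∈ Icc (0 : ℝ) 1 := ⟨zero_le_one, le_rfl⟩
  have hη0 : 0 ≤ S.eta := S.eta_pos.le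
  have hη1 : S.eta ≤ 1 := S.eta_le_one
  have hk0 : 0 ≤ k := by linarith only [hk]
  have hs0 : 0 ≤ Real.sqrt S.eta := Real.sqrt_nonneg _
  have hs1 : Real.sqrt S.eta ≤ 1 := Real.sqrt_le_one.mpr hη1
  have hs7 : (7071 : ℝ) / 10000 ≤ Real.sqrt S.eta := by
    rw [Real.le_sqrt' (by norm_num)]; norm_num; linarith only [hη]
  -- initial energy `m > 2.1025`
  set m := pairEnergy S.eta (z 0) with hm
  have hm_gt : (841 : ℝ) / 400 < m := by
    have h4 : m = (z 0).1 ^ 2 + S.eta * (z 0).2 ^ 2 := rfl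
    nlinarith only [ha0, h4, mul_nonneg hη0 (sq_nonneg (z 0).2)]
  have hm0 : 0 ≤ 1 + m := by linarith only [hm_gt]
  -- the relative energy band on the tick, in rational form
  have band := pseudo_energy_band_rel hη hη1 k hε0 hcont hderiv hdef
  have hWlo : ∀ t ∈ Icc (0 : ℝ) 1, (623 * m - 2) / 625 ≤ pairEnergy S.eta (z t) := by
    intro t ht
    have h2 := mul_le_mul_of_nonneg_left (by linarith only [Real.add_one_le_exp (-(2 * (4 * ε)) * t)]
      : 1 - 2 * (4 * ε) * t ≤ Real.exp (-(2 * (4 * ε)) * t)) hm0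
    have h4 := mul_le_mul_of_nonneg_left
      (by nlinarith only [ht.1, ht.2, hε, hε0] : 2 * (4 * ε) * t ≤ 2 / 625) hm0
    linarith only [(band t ht).1, h2, h4]
  have hWhi : ∀ t ∈ Icc (0 : ℝ) 1, pairEnergy S.eta (z t) ≤ (625 * m + 2) / 623 := by
    intro t ht
    have h1 := (band t ht).2
    have hx1 : 2 * (4 * ε) * t ≤ 2 / 625 := by nlinarith only [ht.1, ht.2, hε, hε0]
    have he : Real.exp (2 * (4 * ε) * t) ≤ 625 / 623 :=
      calc Real.exp (2 * (4 * ε) * t) ≤ Real.exp (2 / 625) := Real.exp_le_exp.2 hx1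
        _ ≤ 1 / (1 - 2 / 625) :=
          Real.exp_bound_div_one_sub_of_interval (by norm_num) (by norm_num)
        _ = 625 / 623 := by norm_num
    linarith only [h1, mul_le_mul_of_nonneg_left he hm0]
  -- the energy floor `r`: `r² = L > 2`, `r ≤ R ≤ 1.01 r` on the tick
  set L := (623 * m - 2) / 625 with hL
  have hL_gt : (2 : ℝ) < L := by rw [hL]; linarith only [hm_gt]
  set r := Real.sqrt L with hr
  have hr0 : 0 < r := Real.sqrt_pos.2 (by linarith only [hL_gt])
  have hrne : r ≠ 0 := hr0.ne'
  have hr2 : r ^ 2 = L := Real.sq_sqrt (by linarith only [hL_gt])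
  have hRge : ∀ t ∈ Icc (0 : ℝ) 1, r ≤ qRad S.eta (z t) := fun t ht =>
    Real.sqrt_le_sqrt (hWlo t ht)
  have hM : (625 * m + 2) / 623 ≤ (101 / 100 * r) ^ 2 := by
    rw [mul_pow, hr2, hL]; linarith only [hm_gt]
  have hRle : ∀ t ∈ Icc (0 : ℝ) 1, qRad S.eta (z t) ≤ 101 / 100 * r := fun t ht =>
    calc qRad S.eta (z t) = Real.sqrt (pairEnergy S.eta (z t)) := rfl
      _ ≤ Real.sqrt ((101 / 100 * r) ^ 2) := Real.sqrt_le_sqrt ((hWhi t ht).trans hM)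
      _ = 101 / 100 * r := Real.sqrt_sq (by linarith only [hr0])
  -- the defect is ABSOLUTELY bounded along the tick
  set ε' := ε * (1 + 303 / 200 * r) with hε'
  have hε'0 : 0 ≤ ε' := mul_nonneg hε0 (by linarith only [hr0])
  have hdef' : ∀ t ∈ Ico (0 : ℝ) 1, ‖w t - quadVF k S.eta (z t)‖ ≤ ε' := fun t ht =>
    (hdef t ht).trans (by rw [hε']; exact mul_le_mul_of_nonneg_left (by
      linarith only [norm_le_qRad hη (z t), hRle t (Ico_subset_Icc_self ht)]) hε0)
  rcases le_total m 8 with hm8 | hm8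
  · -- SMALL amplitudes: the defect is absolutely `≤ 1/400`; the absolute theorem applies
    have hr283 : r ≤ 283 / 100 := by
      rw [hr, ← Real.sqrt_sq (by norm_num : (0 : ℝ) ≤ 283 / 100)]
      exact Real.sqrt_le_sqrt (by rw [hL]; linarith only [hm8])
    have hε'le : ε' ≤ 1 / 400 := by
      have := mul_le_mul_of_nonneg_right hε (by linarith only [hr0] : (0 : ℝ) ≤ 1 + 303 / 200 * r)
      rw [hε']; nlinarith only [this, hr283]
    exact quad_pseudoOrbit_datO hS hη hη2 hk hε'le hcont hderiv hdef' h0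
  -- LARGE amplitudes: `r ≥ 2.8`, `ε' ≤ r/1250`
  have hr28 : (14 : ℝ) / 5 ≤ r := by
    rw [hr, Real.le_sqrt' (by norm_num), hL]; linarith only [hm8]
  have hε'r : ε' ≤ r / 1250 := by
    have := mul_le_mul_of_nonneg_right hε (by linarith only [hr0] : (0 : ℝ) ≤ 1 + 303 / 200 * r)
    rw [hε']; linarith only [this, hr28]
  -- the floor of `√η b` on the tick
  have hbge : ∀ t ∈ Icc (0 : ℝ) 1, -(1 / 5 + r / 1250) ≤ Real.sqrt S.eta * (z t).2 := by
    intro t ht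
    have h := pseudo_snd_lower hk0 hcont hderiv hdef' t ht
    have hb := (abs_lt.1 hb0).1
    have hεt := mul_le_mul_of_nonneg_left ht.2 hε'0
    have hX0 : (0 : ℝ) ≤ 1 / 5 + r / 1250 := by linarith only [hr0]
    have h1 := mul_nonneg hs0 (show (0 : ℝ) ≤ (z t).2 + (1 / 5 + r / 1250) by
      linarith only [h, hb, hεt, hε'r])
    nlinarith only [h1, mul_nonneg (sub_nonneg.2 hs1) hX0]
  -- gap decay with rate `κ = 3.9 r`
  set κ := 39 / 10 * r with hκ
  have hκ0 : 0 < κ := by rw [hκ]; linarith only [hr0]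
  have hks : (42426 : ℝ) / 10000 ≤ k * Real.sqrt S.eta := by
    have := mul_le_mul hk hs7 (by norm_num) hk0; linarith only [this]
  have hκle : ∀ t ∈ Ico (0 : ℝ) 1,
      κ ≤ k * Real.sqrt S.eta * (qRad S.eta (z t) + Real.sqrt S.eta * (z t).2) := by
    intro t ht
    have hX : (1249 : ℝ) / 1250 * r - 1 / 5 ≤ qRad S.eta (z t) + Real.sqrt S.eta * (z t).2 := by
      linarith only [hRge t (Ico_subset_Icc_self ht), hbge t (Ico_subset_Icc_self ht)]
    have hX0 : (0 : ℝ) ≤ 1249 / 1250 * r - 1 / 5 := by linarith only [hr28]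
    have h1 := mul_le_mul hks hX hX0 (mul_nonneg hk0 hs0)
    rw [hκ]; linarith only [h1, hr28]
  have hWne : ∀ t ∈ Ico (0 : ℝ) 1, pairEnergy S.eta (z t) ≠ 0 := fun t ht =>
    (by linarith only [hWlo t (Ico_subset_Icc_self ht), hL_gt] : 0 < pairEnergy S.eta (z t)).ne'
  have hgap := pseudo_gap_decay hη0 hη1 k hκ0 hε'0 hcont hderiv hdef' hWne hκle
  have hp0 : qRad S.eta (z 0) - Real.sqrt S.eta * (z 0).2 ≤ 101 / 100 * r + 1 / 5 := by
    have h1 := hRle 0 ⟨le_rfl, zero_le_one⟩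
    have h2 := mul_nonneg hs0 (show (0 : ℝ) ≤ (z 0).2 + 1 / 5 by linarith only [(abs_lt.1 hb0).1])
    nlinarith only [h1, h2, hs1, hs0]
  have hp0nn : 0 ≤ qRad S.eta (z 0) - Real.sqrt S.eta * (z 0).2 := by
    linarith only [sqrt_mul_abs_snd_le_qRad hη0 (z 0),
      mul_le_mul_of_nonneg_left (le_abs_self (z 0).2) hs0]
  have hE2 : Real.exp (-2) ≤ 1 / 7 := by
    have h1 := Real.exp_one_gt_d9
    have h' : Real.exp (-2) * (Real.exp 1 * Real.exp 1) = 1 := by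
      rw [← Real.exp_add, ← Real.exp_add]; norm_num
    nlinarith only [mul_nonneg (Real.exp_pos (-2)).le (mul_nonneg (Real.exp_pos 1).le
      (Real.exp_pos 1).le), h', h1, mul_nonneg (Real.exp_pos (-2)).le (Real.exp_pos 1).le]
  -- phase boundary `t₁ = 20/(39 r)`; on `[t₁, 1]`, `√η b ≥ 0.845 r`
  set t₁ := 20 / (39 * r) with ht₁
  have ht₁0 : 0 < t₁ := by rw [ht₁]; positivity
  have ht₁1 : t₁ ≤ 1 / 5 := by
    rw [ht₁, div_le_iff₀ (by linarith only [hr0])]; linarith only [hr28]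
  have ht₁1' : t₁ ≤ 1 := ht₁1.trans (by norm_num)
  have hκt₁ : κ * t₁ = 2 := by rw [hκ, ht₁]; field_simp; ring
  have hsb : ∀ t ∈ Icc t₁ 1, (169 : ℝ) / 200 * r ≤ Real.sqrt S.eta * (z t).2 := by
    intro t ht
    have ht' : t ∈ Icc (0 : ℝ) 1 := ⟨ht₁0.le.trans ht.1, ht.2⟩
    have h := hgap t ht'
    have hR := hRge t ht'
    have hexp : Real.exp (-κ * t) ≤ 1 / 7 :=
      calc Real.exp (-κ * t) ≤ Real.exp (-2) :=
            Real.exp_le_exp.2 (by nlinarith only [hκt₁, ht.1, hκ0])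
        _ ≤ 1 / 7 := hE2
    have h3 : 3 * ε' / κ ≤ 1 / 1625 := by
      rw [div_le_iff₀ hκ0, hκ]; linarith only [hε'r]
    have h4 := mul_le_mul_of_nonneg_left hexp hp0nn
    linarith only [h, hR, h3, h4, hp0, hr28]
  have hbpos : ∀ t ∈ Icc t₁ 1, (169 : ℝ) / 200 * r ≤ (z t).2 := by
    intro t ht
    have h := hsb t ht
    have hpos : 0 < (z t).2 := by
      by_contra hc; push Not at hc; nlinarith only [h, hr0, mul_nonneg hs0 (neg_nonneg.2 hc)]
    linarith only [mul_le_mul_of_nonneg_right hs1 hpos.le, h]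
  -- phase 2 on `[t₁, 1]`: `a²` contracts at rate `c = 3.5 r ≤ kηb` up to the forcing `ε'²/c`
  set c := 7 / 2 * r with hc
  have hc0 : 0 < c := by rw [hc]; linarith only [hr0]
  have hcne : c ≠ 0 := hc0.ne'
  have hrate : ∀ t ∈ Ico t₁ 1, c ≤ k * S.eta * (z t).2 := by
    intro t ht
    have h := hsb t (Ico_subset_Icc_self ht)
    have h1 := mul_le_mul hks h (by linarith only [hr0]) (mul_nonneg hk0 hs0)
    have h2 : k * Real.sqrt S.eta * (Real.sqrt S.eta * (z t).2) = k * S.eta * (z t).2 := by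
      rw [show k * Real.sqrt S.eta * (Real.sqrt S.eta * (z t).2)
          = k * (Real.sqrt S.eta * Real.sqrt S.eta) * (z t).2 by ring, Real.mul_self_sqrt hη0]
    rw [h2] at h1
    rw [hc]; linarith only [h1, hr0]
  set u : ℝ → ℝ := fun t => (z t).1 ^ 2 with hu
  have hucont : ContinuousOn u (Icc t₁ 1) :=
    (hcont.mono (Icc_subset_Icc ht₁0.le le_rfl)).fst.pow 2
  have hu' : ∀ t ∈ Ico t₁ 1, HasDerivWithinAt u (2 * (z t).1 * (w t).1) (Ici t) t := fun t ht =>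
    hasDerivWithinAt_sq_comp (hasDerivWithinAt_fst_comp (hderiv t ⟨ht₁0.le.trans ht.1, ht.2⟩))
  have hbound : ∀ t ∈ Ico t₁ 1, 2 * (z t).1 * (w t).1 ≤ -c * u t + ε' ^ 2 / c := by
    intro t ht
    have ht' : t ∈ Ico (0 : ℝ) 1 := ⟨ht₁0.le.trans ht.1, ht.2⟩
    have h1 := abs_fst_sub_le (hdef' t ht')
    have hV : (quadVF k S.eta (z t)).1 = -(k * S.eta * (z t).1 * (z t).2) := rfl
    rw [hV] at h1
    have h2 := hrate t ht
    have h3 : 2 * (z t).1 * ((w t).1 - -(k * S.eta * (z t).1 * (z t).2)) ≤ 2 * |(z t).1| * ε' :=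
      calc 2 * (z t).1 * ((w t).1 - -(k * S.eta * (z t).1 * (z t).2))
          ≤ |2 * (z t).1 * ((w t).1 - -(k * S.eta * (z t).1 * (z t).2))| := le_abs_self _
        _ = 2 * |(z t).1| * |(w t).1 - -(k * S.eta * (z t).1 * (z t).2)| := by
          rw [abs_mul, abs_mul, abs_two]
        _ ≤ 2 * |(z t).1| * ε' := mul_le_mul_of_nonneg_left h1 (by positivity)
    have h4 : 2 * |(z t).1| * ε' ≤ c * (z t).1 ^ 2 + ε' ^ 2 / c := by
      rw [← sq_abs (z t).1]
      have key : 0 ≤ (c * |(z t).1| - ε') ^ 2 := sq_nonneg _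
      have h' : 2 * |(z t).1| * ε' * c ≤ (c * |(z t).1| ^ 2 + ε' ^ 2 / c) * c := by
        rw [add_mul, div_mul_cancel₀ _ hcne]; nlinarith only [key]
      exact le_of_mul_le_mul_right h' hc0
    have h5 : 2 * (z t).1 * (-(k * S.eta * (z t).1 * (z t).2)) ≤ -(2 * c) * (z t).1 ^ 2 := by
      have := mul_le_mul_of_nonneg_right h2 (sq_nonneg (z t).1)
      nlinarith only [this]
    simp only [hu]
    linarith only [h3, h4, h5]
  have hgr := le_gronwallBound_of_liminf_deriv_right_le (f := u)
    (f' := fun t => 2 * (z t).1 * (w t).1) (δ := u t₁) (K := -c) (ε := ε' ^ 2 / c) (a := t₁)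
    (b := 1) hucont
    (fun x hx q hq => by
      simpa [slope_def_module, smul_eq_mul] using (hu' x hx).liminf_right_slope_le hq)
    le_rfl hbound 1 ⟨ht₁1', le_rfl⟩
  have hcne' : -c ≠ 0 := by linarith only [hc0]
  rw [gronwallBound_of_K_ne_0 hcne'] at hgr
  -- the exponent `y = c (1 - t₁) = 3.5 r - 70/39 ≥ 8` and `e^{-y} r² ≤ 24/441`
  set y := c * (1 - t₁) with hy
  have hyr : y = 7 / 2 * r - 70 / 39 := by rw [hy, hc, ht₁]; field_simp; ring
  have hy8 : 8 ≤ y := by rw [hyr]; linarith only [hr28]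
  have hE0 : 0 < Real.exp (-c * (1 - t₁)) := Real.exp_pos _
  have hEy : Real.exp (-c * (1 - t₁)) * y ^ 4 ≤ 24 := by
    have h1 := Real.pow_div_factorial_le_exp y (by linarith only [hy8]) 4
    norm_num [Nat.factorial] at h1
    have h2 : Real.exp (-c * (1 - t₁)) * Real.exp y = 1 := by
      rw [← Real.exp_add, hy]; norm_num
    have h3 := mul_le_mul_of_nonneg_left h1 hE0.le
    linarith only [h3, h2]
  have hr2y : 441 * r ^ 2 ≤ y ^ 4 := by
    have h1 : 441 * r ^ 2 = 36 * (y + 70 / 39) ^ 2 := by rw [hyr]; ring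
    have h2 : 36 * (y + 70 / 39) ^ 2 ≤ 64 * y ^ 2 := by nlinarith only [hy8, sq_nonneg (y - 8)]
    have h3 : 64 * y ^ 2 ≤ y ^ 4 := by
      nlinarith only [mul_nonneg (mul_nonneg (sq_nonneg y) (sub_nonneg.2 hy8))
        (show (0 : ℝ) ≤ y + 8 by linarith only [hy8])]
    rw [h1]; exact h2.trans h3
  have hut₁ : u t₁ ≤ (101 / 100 * r) ^ 2 := by
    have h1 := hRle t₁ ⟨ht₁0.le, ht₁1'⟩
    have h2 : (z t₁).1 ^ 2 ≤ qRad S.eta (z t₁) ^ 2 := by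
      have h3 : qRad S.eta (z t₁) ^ 2 = (z t₁).1 ^ 2 + S.eta * (z t₁).2 ^ 2 :=
        Real.sq_sqrt (pairEnergy_nonneg hη0 _)
      rw [h3]; nlinarith only [mul_nonneg hη0 (sq_nonneg (z t₁).2)]
    simp only [hu]
    exact h2.trans (pow_le_pow_left₀ (Real.sqrt_nonneg _) h1 2)
  have hfirst : u t₁ * Real.exp (-c * (1 - t₁)) ≤ 10201 / 10000 * (24 / 441) := by
    have h1 := mul_le_mul_of_nonneg_right hut₁ hE0.le
    have h2 : r ^ 2 * Real.exp (-c * (1 - t₁)) ≤ 24 / 441 := by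
      have := mul_le_mul_of_nonneg_left hr2y hE0.le
      nlinarith only [this, hEy]
    nlinarith only [h1, h2]
  have hsecond : ε' ^ 2 / c / -c * (Real.exp (-c * (1 - t₁)) - 1) ≤ (1 / 4375) ^ 2 := by
    have h1 : ε' / c ≤ 1 / 4375 := by
      rw [div_le_iff₀ hc0, hc]; linarith only [hε'r]
    have h2 : ε' ^ 2 / c / -c * (Real.exp (-c * (1 - t₁)) - 1)
        = (ε' / c) ^ 2 * (1 - Real.exp (-c * (1 - t₁))) := by
      field_simp; ring
    rw [h2]
    have h3 : (ε' / c) ^ 2 ≤ (1 / 4375) ^ 2 := pow_le_pow_left₀ (div_nonneg hε'0 hc0.le) h1 2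
    nlinarith only [h3, mul_nonneg (sq_nonneg (ε' / c)) hE0.le]
  have hu1 : u 1 ≤ 1 / 17 := by linarith only [hgr, hfirst, hsecond]
  have ha2 : (z 1).1 ^ 2 ≤ 1 / 17 := by simpa only [hu] using hu1
  -- first coordinate `|a(1)| ≤ 1/4`, second coordinate `b(1) ≥ 0.845 r > 3/2`
  have ha1 : |(z 1).1| ≤ 1 / 4 := by
    have h' : (z 1).1 ^ 2 ≤ (1 / 4) ^ 2 := by linarith only [ha2]
    have := sq_le_sq.1 h'
    rwa [abs_of_pos (by norm_num : (0 : ℝ) < 1 / 4)] at this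
  have hb1 : (3 : ℝ) / 2 ≤ (z 1).2 := by
    have := hbpos 1 ⟨ht₁1', le_rfl⟩
    linarith only [this, hr28]
  simp only [AoutO, Params.reg, Set.mem_prod, Set.mem_Icc, Set.mem_Ici]
  exact ⟨⟨by linarith only [(abs_le.1 ha1).1], (abs_le.1 ha1).2⟩, hb1⟩

end BlockDesign

end Summit.NavierStokesRegularity.FluidComputer
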